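import Mathlib
import HarnessLib
import Literature.Probability.Percolation.Percolation
import Literature.Probability.Percolation.RSW
import Summits.CriticalPhenomena.PercolationContinuityZ3.Theorems.PercTreeValueTetrahedronLogConvexityCertDefs

/-!
# Truncation removal for the two-seed certificate (stub `stub_contR`)

Crux `TetrahedronLogConvexity` (stmt-CriticalPhenomena-7801), line `Sketch` (certificate form).
The objects are those of `PercTreeValueTetrahedronLogConvexityCertDefs.lean`: the open lattice
graph `latOpen ω = ℤ³ ⊓ openGraph ω`, the truncated merge layer
`NR r R ω = min(⌈d_ω(0,a_r)/2⌉, R)` and the merge event `AR r R = {NR < R}`.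

Main result `stub_contR`:
* `AR r R ⊆ {0 ↔ a_r}`: merging before layer `R` means `d_ω(0,a_r) ≤ 2R - 2 < ∞` in the open
  lattice graph, a subgraph of the open graph;
* `P(A_R ∩ {0 ↔ b_r}) → P({0 ↔ a_r} ∩ {0 ↔ b_r})` as `R → ∞`: the events `A_R` increase to
  `{d_ω(0,a_r) < ∞}` (continuity of the measure from below, `tendsto_measure_iUnion_atTop`),
  and the latter agrees with `{0 ↔ a_r}` off the null set of configurations with a non-lattice
  open pair (`ae_subset_edgeSet`).
-/

noncomputable section

open MeasureTheory Filter
open Literature.Probability.Percolation Literature.Probability.LatticeModels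

namespace Summit.CriticalPhenomena.PercolationContinuityZ3.Theorems.TetrahedronLogConvexity.Cert

/-- Membership in `A_R`: some `n < R` has `d_ω(0,a_r) ≤ 2n` (`Nat.find_lt_iff`; for `n < R` the
truncation disjunct `n = R` is void). [folklore] -/
theorem contR_mem_AR_iff {r R : ℕ} {ω : BondConfig (Site 3)} :
    ω ∈ AR r R ↔ ∃ n, n < R ∧ (latOpen ω).edist 0 (vA r) ≤ 2 * (n : ℕ∞) := by
  classical
  rw [mem_AR_iff]
  unfold NR
  rw [Nat.find_lt_iff]
  constructor
  · rintro ⟨n, hn, h | h⟩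
    · exact ⟨n, hn, h⟩
    · omega
  · rintro ⟨n, hn, h⟩
    exact ⟨n, hn, Or.inl h⟩

/-- On `A_R` the seeds `0` and `a_r` are joined in the open lattice graph. [folklore] -/
theorem contR_latReachable_of_mem_AR {r R : ℕ} {ω : BondConfig (Site 3)} (h : ω ∈ AR r R) :
    (latOpen ω).Reachable 0 (vA r) := by
  obtain ⟨n, -, hn⟩ := contR_mem_AR_iff.1 h
  have h2 : (2 * (n : ℕ∞)) ≠ ⊤ := by exact_mod_cast ENat.coe_ne_top (2 * n)
  exact SimpleGraph.reachable_of_edist_ne_top (ne_top_of_le_ne_top h2 hn)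

/-- `A_R ⊆ {0 ↔ a_r}` (the open lattice graph is a subgraph of the open graph). [folklore] -/
theorem contR_AR_subset (r R : ℕ) : AR r R ⊆ openConn 0 (vA r) := fun ω h =>
  show (openGraph ω).Reachable 0 (vA r) from
    (contR_latReachable_of_mem_AR h).mono (latOpen_le_openGraph ω)

/-- `R ↦ A_R` is increasing. [folklore] -/
theorem contR_AR_mono (r : ℕ) : Monotone (fun R => AR r R) := by
  intro R R' hRR' ω h
  obtain ⟨n, hn, h⟩ := contR_mem_AR_iff.1 h
  exact contR_mem_AR_iff.2 ⟨n, lt_of_lt_of_le hn hRR', h⟩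

/-- `⋃_R A_R = {d_ω(0,a_r) < ∞}` = `{0 ↔ a_r` in the open lattice graph`}`. [folklore] -/
theorem contR_iUnion_AR (r : ℕ) :
    (⋃ R, AR r R) = {ω : BondConfig (Site 3) | (latOpen ω).Reachable 0 (vA r)} := by
  ext ω
  simp only [Set.mem_iUnion, Set.mem_setOf_eq]
  constructor
  · rintro ⟨R, hR⟩
    exact contR_latReachable_of_mem_AR hR
  · intro h
    have hne : (latOpen ω).edist 0 (vA r) ≠ ⊤ := SimpleGraph.edist_ne_top_iff_reachable.2 h
    obtain ⟨n, hn⟩ : ∃ n : ℕ, (latOpen ω).edist 0 (vA r) = n := ⟨_, (ENat.coe_toNat hne).symm⟩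
    refine ⟨n + 1, contR_mem_AR_iff.2 ⟨n, Nat.lt_succ_self n, ?_⟩⟩
    rw [hn]
    exact_mod_cast (by omega : n ≤ 2 * n)

/-- On lattice configurations `ω ⊆ E(ℤ³)` the open graph is a subgraph of `ℤ³`, so open and
open-lattice connections coincide. [folklore] -/
theorem contR_latReachable_iff_of_subset {ω : BondConfig (Site 3)} (hω : ω ⊆ (zdGraph 3).edgeSet)
    {x y : Site 3} : (latOpen ω).Reachable x y ↔ (openGraph ω).Reachable x y := by
  refine ⟨fun h => h.mono (latOpen_le_openGraph ω), fun h => h.mono ?_⟩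
  have hle : openGraph ω ≤ zdGraph 3 := fun a b hab => hω ((openGraph_adj ω a b).1 hab).1
  show openGraph ω ≤ zdGraph 3 ⊓ openGraph ω
  exact le_inf hle le_rfl

/-- `{0 ↔ a_r` in the open lattice graph`} = {0 ↔ a_r}` almost surely (`P_p` is carried by lattice
configurations, `ae_subset_edgeSet`). [folklore] -/
theorem contR_ae_eq (r : ℕ) :
    ({ω : BondConfig (Site 3) | (latOpen ω).Reachable 0 (vA r)} : Set (BondConfig (Site 3)))
      =ᵐ[Pc] openConn 0 (vA r) := by
  rw [Filter.eventuallyEq_set]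
  filter_upwards [ae_subset_edgeSet (zdGraph 3) (criticalProbI 3)] with ω hω
  exact contR_latReachable_iff_of_subset hω

/-- **Truncation removal**: `A_R ⊆ {0 ↔ a_r}` and `P(A_R, 0 ↔ b_r) → P(0 ↔ a_r, 0 ↔ b_r)` as
`R → ∞` (continuity from below along the increasing events `A_R ↑ {0 ↔ a_r}` a.s.). [folklore] -/
theorem stub_contR : ∀ r : ℕ,
    (∀ R : ℕ, AR r R ⊆ openConn 0 (vA r)) ∧
    Tendsto (fun R : ℕ => Pc.real (AR r R ∩ openConn 0 (vB r))) atTop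
      (nhds (Pc.real (openConn 0 (vA r) ∩ openConn 0 (vB r)))) := by
  intro r
  refine ⟨contR_AR_subset r, ?_⟩
  have hmono : Monotone (fun R => AR r R ∩ openConn 0 (vB r)) := fun R R' h =>
    Set.inter_subset_inter_left _ (contR_AR_mono r h)
  have hU : (⋃ R, AR r R ∩ openConn 0 (vB r)) =
      {ω : BondConfig (Site 3) | (latOpen ω).Reachable 0 (vA r)} ∩ openConn 0 (vB r) := by
    rw [← Set.iUnion_inter, contR_iUnion_AR r]
  have hmeas : Pc (⋃ R, AR r R ∩ openConn 0 (vB r)) = Pc (openConn 0 (vA r) ∩ openConn 0 (vB r)) := by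
    rw [hU]
    exact measure_congr ((contR_ae_eq r).inter EventuallyEq.rfl)
  have h1 : Tendsto (Pc ∘ fun R => AR r R ∩ openConn 0 (vB r)) atTop
      (nhds (Pc (openConn 0 (vA r) ∩ openConn 0 (vB r)))) :=
    hmeas ▸ tendsto_measure_iUnion_atTop hmono
  have h2 := (ENNReal.tendsto_toReal (measure_ne_top Pc _)).comp h1
  simpa only [measureReal_def, Function.comp_def] using h2

end Summit.CriticalPhenomena.PercolationContinuityZ3.Theorems.TetrahedronLogConvexity.Cert
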